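import Summits.ResolutionOfSingularities.ResolutionOfSingularities.Theorems.EquisingularLiftEquisingularLiftNatFibreIntegral
import Literature.AlgebraicGeometry.Resolution.RegularLocalRingsQuotient
import Literature.AlgebraicGeometry.Resolution.KollarMaxContactChartsFieldChange
import Mathlib.RingTheory.KrullDimension.Regular
import HarnessLib

/-!
# [OURS · L1 W4.5(b) · EL♮(3) · WIDTH TABLE D8, support debt S-D8-LIFT, brick (N-C2′)] REGULAR POINTS OF THE TOTAL SPACE FROM REGULAR POINTS OF THE
# SPECIAL FIBRE in a model square over a DVR — `𝒪_{X,j y} ⧸ (ϖ̃) ≅ 𝒪_{G,y}` with `ϖ̃ ∈ 𝔪` a non-zero-divisor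

res-L1-w45b-nose-w1 g5 (WIDTH seat D-0157 DOOR 1; S-D8-LIFT second pen under res-L1-w45b-stub-4 g14's plan, shape asked on the bus
2026-08-29T04:41:55Z).  OURS; NOT a statement of any manuscript; AI-written, weaker than expert review.  No `sorry`; standard axioms; DEF-FREE.
`--supports stmt-ResolutionOfSingularities-20148 --as helper`, counted 0.  EL♮(3) is NOT proved; resolution in positive characteristic is NOT proved.

SETTING (the chain's MODEL SQUARE): `O` a DVR, `θ : O ↠ k` onto a field, `f : X ⟶ Spec O`, `j : G ⟶ X`, `t : G ⟶ Spec k` with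
`IsPullback j t f (Spec θ)` (`G` = the special fibre), `X` locally Noetherian, `Flat f`; `ϖ` a uniformizer of `O` and `ϖ̃` its germ at `j y`
(spelled `(X.presheaf.Γgerm (j y)).hom (f.appTop.hom ((Scheme.ΓSpecIso (.of O)).inv.hom ϖ))`, as in ✓ `ker_stalkMap_model_le`).

WHAT (all PROVED; the pattern is res-L1-w45b-stub-4 ✓ `FibreIntegral.isDomain_stalk_fibre`, …NatFibreIntegral :115).
* `ModelSquare.ker_stalkMap_eq_span_germ` — `ker (j♯_y) = (ϖ̃)` (✓ `ker_stalkMap_model_le` + ✓ `stalkMap_model_varpi`);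
  `ModelSquare.germ_mem_maximalIdeal` — `ϖ̃ ∈ 𝔪`; `ModelSquare.germ_mem_nonZeroDivisors` — `ϖ̃` is a non-zero-divisor (`Flat f`);
  `ModelSquare.exists_quotient_span_germ_ringEquiv` — `𝒪_{X,j y} ⧸ (ϖ̃) ≃+* 𝒪_{G,y}` (the stalk map of the closed immersion `j` is onto).
* ★ (i) `ModelSquare.isRegularLocalRing_stalk_of_isRegularLocalRing_fibre_stalk` — `𝒪_{G,y}` regular ⇒ `𝒪_{X,j y}` regular (Matsumura 19.2 (II), tree
  ✓ `IsRegularLocalRing.of_quotient_span_singleton`).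
* ★ (ii) `ModelSquare.ringKrullDim_stalk_eq_fibre_add_one` — `dim 𝒪_{X,j y} = dim 𝒪_{G,y} + 1` (Mathlib, `ϖ̃` regular in `𝔪`).
* ★ (iii) `ModelSquare.germ_notMem_sq` — `𝒪_{G,y}` regular ⇒ `ϖ̃ ∉ 𝔪²_{X,j y}` (Matsumura 14.2 converse, tree ✓ `notMem_sq_of_isRegularLocalRing_quotient`).
These are the «off the nodes» inputs of stub-4's (C5)/(C6): at a closed special-fibre point where the lift's fibre `Z̃` is regular the total space is
regular (i), and at a node the uniformizer germ is a regular PARAMETER of the ambient (iii), so brick (β)'s `f + ϖ g` analysis applies.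
-/

set_option linter.dupNamespace false -- mandated namespace `Summit.<Summit>.<Problem>` of this single-conjunct summit

noncomputable section

open CategoryTheory CategoryTheory.Limits AlgebraicGeometry TopologicalSpace IsLocalRing
open Literature.AlgebraicGeometry.Resolution
open Summit.ResolutionOfSingularities.ResolutionOfSingularities.Cruxes.EquisingularLift.StrataSplit

namespace Summit.ResolutionOfSingularities.ResolutionOfSingularities.Cruxes.EquisingularLiftNat.Sections.ModelSquare

variable (O : Type) [CommRing O] [IsDomain O] [IsDiscreteValuationRing O] {k : Type} [Field k] (θ : O →+* k)
  (hθ : Function.Surjective θ) {X G : Scheme.{0}} (f : X ⟶ Spec (.of O)) (j : G ⟶ X) (t : G ⟶ Spec (.of k))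
  (hsq : IsPullback j t f (Spec.map (CommRingCat.ofHom θ)))

include hθ hsq in
/-- **`ker (j♯_y) = (ϖ̃)`** in a model square over a DVR (`⊆` is ✓ `ker_stalkMap_model_le`; `⊇` since `j♯` kills `𝔪_O`). [folklore] -/
theorem ker_stalkMap_eq_span_germ (y : G) (ϖ : O) (hϖ : Irreducible ϖ) :
    RingHom.ker (j.stalkMap y).hom = Ideal.span {(X.presheaf.Γgerm (j y)).hom (f.appTop.hom ((Scheme.ΓSpecIso (.of O)).inv.hom ϖ))} :=
  le_antisymm (ker_stalkMap_model_le O k θ hθ f j t hsq y ϖ hϖ)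
    ((Ideal.span_singleton_le_iff_mem _).mpr ((RingHom.mem_ker).mpr
      (stalkMap_model_varpi θ hθ f j t hsq y ϖ (hϖ.maximalIdeal_eq ▸ Ideal.mem_span_singleton_self ϖ))))

include hθ hsq in
/-- **`ϖ̃ ∈ 𝔪_{X,j y}`** (its image under `j♯_y` is `0`). [folklore] -/
theorem germ_mem_maximalIdeal (y : G) (ϖ : O) (hϖ : Irreducible ϖ) :
    (X.presheaf.Γgerm (j y)).hom (f.appTop.hom ((Scheme.ΓSpecIso (.of O)).inv.hom ϖ)) ∈ maximalIdeal (X.presheaf.stalk (j y)) := by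
  rw [IsLocalRing.mem_maximalIdeal, mem_nonunits_iff]
  intro hu
  have h := hu.map (j.stalkMap y).hom
  rw [stalkMap_model_varpi θ hθ f j t hsq y ϖ (hϖ.maximalIdeal_eq ▸ Ideal.mem_span_singleton_self ϖ)] at h
  exact not_isUnit_zero h

omit [IsDiscreteValuationRing O] in
/-- **`ϖ̃` is a non-zero-divisor in `𝒪_{X,j y}`** when `f` is flat (the flat `f♯` preserves the non-zero-divisor `ϖ` of the integral `Spec O`). [folklore] -/
theorem germ_mem_nonZeroDivisors [Flat f] (y : G) (ϖ : O) (hϖ : Irreducible ϖ) :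
    (X.presheaf.Γgerm (j y)).hom (f.appTop.hom ((Scheme.ΓSpecIso (.of O)).inv.hom ϖ)) ∈ nonZeroDivisors (X.presheaf.stalk (j y)) := by
  have hgerm : ((Spec (.of O)).presheaf.Γgerm (f (j y))).hom ((Scheme.ΓSpecIso (.of O)).inv.hom ϖ) ∈
      nonZeroDivisors ((Spec (.of O)).presheaf.stalk (f (j y))) := by
    apply mem_nonZeroDivisors_of_ne_zero
    intro h0
    have hinj := germ_injective_of_isIntegral (Spec (.of O)) (U := ⊤) (f (j y)) trivial
    have h1 : (Spec (.of O)).presheaf.germ ⊤ (f (j y)) trivial ((Scheme.ΓSpecIso (.of O)).inv.hom ϖ) =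
        (Spec (.of O)).presheaf.germ ⊤ (f (j y)) trivial 0 := by
      rw [map_zero]; exact h0
    have h2 : (Scheme.ΓSpecIso (.of O)).inv.hom ϖ = 0 := hinj h1
    have h3 : ϖ = 0 := by simpa using congrArg (fun z => (Scheme.ΓSpecIso (.of O)).hom.hom z) h2
    exact hϖ.ne_zero h3
  have h := map_mem_nonZeroDivisors_of_flat (f.stalkMap (j y)).hom (Flat.stalkMap f (j y)) hgerm
  rwa [stalkMap_Γgerm_apply'] at h

include hθ hsq in
/-- **`𝒪_{X,j y} ⧸ (ϖ̃) ≅ 𝒪_{G,y}`**: the stalk map of the closed immersion `j` is onto with kernel `(ϖ̃)`. [folklore] -/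
theorem exists_quotient_span_germ_ringEquiv (y : G) (ϖ : O) (hϖ : Irreducible ϖ) :
    Nonempty ((X.presheaf.stalk (j y) ⧸ Ideal.span {(X.presheaf.Γgerm (j y)).hom (f.appTop.hom ((Scheme.ΓSpecIso (.of O)).inv.hom ϖ))}) ≃+*
      G.presheaf.stalk y) :=
  ⟨(Ideal.quotEquivOfEq (ker_stalkMap_eq_span_germ O θ hθ f j t hsq y ϖ hϖ).symm).trans
    (RingHom.quotientKerEquivOfSurjective (stalkMap_model_surjective θ hθ f j t hsq y))⟩

include hθ hsq in
/-- ★ (i) **A REGULAR POINT OF THE SPECIAL FIBRE IS A REGULAR POINT OF THE TOTAL SPACE** (model square over a DVR, `f` flat, `X` locally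
Noetherian): `𝒪_{G,y}` regular ⇒ `𝒪_{X,j y}` regular — Matsumura 19.2 (II) with the regular element `ϖ̃ ∈ 𝔪` and `𝒪_{X,j y} ⧸ (ϖ̃) ≅ 𝒪_{G,y}`.
[folklore; tree ✓ `IsRegularLocalRing.of_quotient_span_singleton`] -/
theorem isRegularLocalRing_stalk_of_isRegularLocalRing_fibre_stalk [IsLocallyNoetherian X] [Flat f] (y : G)
    [IsRegularLocalRing (G.presheaf.stalk y)] : IsRegularLocalRing (X.presheaf.stalk (j y)) := by
  obtain ⟨ϖ, hϖ⟩ := IsDiscreteValuationRing.exists_irreducible O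
  obtain ⟨e⟩ := exists_quotient_span_germ_ringEquiv O θ hθ f j t hsq y ϖ hϖ
  haveI : IsRegularLocalRing (X.presheaf.stalk (j y) ⧸
      Ideal.span {(X.presheaf.Γgerm (j y)).hom (f.appTop.hom ((Scheme.ΓSpecIso (.of O)).inv.hom ϖ))}) :=
    IsRegularLocalRing.of_ringEquiv e.symm
  exact IsRegularLocalRing.of_quotient_span_singleton (germ_mem_maximalIdeal O θ hθ f j t hsq y ϖ hϖ)
    (Module.Flat.isSMulRegular_of_nonZeroDivisors (germ_mem_nonZeroDivisors O f j y ϖ hϖ))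

include hθ hsq in
/-- ★ (ii) **`dim 𝒪_{X,j y} = dim 𝒪_{G,y} + 1`** (model square over a DVR, `f` flat, `X` locally Noetherian): `ϖ̃ ∈ 𝔪` is a non-zero-divisor and
`𝒪_{X,j y} ⧸ (ϖ̃) ≅ 𝒪_{G,y}`. [folklore; Mathlib `ringKrullDim_quotient_span_singleton_succ_eq_ringKrullDim_of_mem_nonZeroDivisors`] -/
theorem ringKrullDim_stalk_eq_fibre_add_one [IsLocallyNoetherian X] [Flat f] (y : G) :
    ringKrullDim (X.presheaf.stalk (j y)) = ringKrullDim (G.presheaf.stalk y) + 1 := by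
  obtain ⟨ϖ, hϖ⟩ := IsDiscreteValuationRing.exists_irreducible O
  obtain ⟨e⟩ := exists_quotient_span_germ_ringEquiv O θ hθ f j t hsq y ϖ hϖ
  rw [← ringKrullDim_eq_of_ringEquiv e]
  exact (ringKrullDim_quotient_span_singleton_succ_eq_ringKrullDim_of_mem_nonZeroDivisors
    (germ_mem_nonZeroDivisors O f j y ϖ hϖ) (germ_mem_maximalIdeal O θ hθ f j t hsq y ϖ hϖ)).symm

include hθ hsq in
/-- ★ (iii) **AT A REGULAR POINT OF THE SPECIAL FIBRE THE UNIFORMIZER GERM IS A REGULAR PARAMETER**: `𝒪_{G,y}` regular ⇒ `ϖ̃ ∉ 𝔪²_{X,j y}`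
(both stalks are then regular, (i); Matsumura 14.2 converse, tree ✓ `notMem_sq_of_isRegularLocalRing_quotient`). [folklore] -/
theorem germ_notMem_sq [IsLocallyNoetherian X] [Flat f] (y : G) [IsRegularLocalRing (G.presheaf.stalk y)] (ϖ : O) (hϖ : Irreducible ϖ) :
    (X.presheaf.Γgerm (j y)).hom (f.appTop.hom ((Scheme.ΓSpecIso (.of O)).inv.hom ϖ)) ∉ (maximalIdeal (X.presheaf.stalk (j y))) ^ 2 := by
  haveI := isRegularLocalRing_stalk_of_isRegularLocalRing_fibre_stalk O θ hθ f j t hsq y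
  obtain ⟨e⟩ := exists_quotient_span_germ_ringEquiv O θ hθ f j t hsq y ϖ hϖ
  haveI : IsRegularLocalRing (X.presheaf.stalk (j y) ⧸
      Ideal.span {(X.presheaf.Γgerm (j y)).hom (f.appTop.hom ((Scheme.ΓSpecIso (.of O)).inv.hom ϖ))}) :=
    IsRegularLocalRing.of_ringEquiv e.symm
  exact notMem_sq_of_isRegularLocalRing_quotient (germ_mem_maximalIdeal O θ hθ f j t hsq y ϖ hϖ)
    (nonZeroDivisors.ne_zero (germ_mem_nonZeroDivisors O f j y ϖ hϖ))

end Summit.ResolutionOfSingularities.ResolutionOfSingularities.Cruxes.EquisingularLiftNat.Sections.ModelSquare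

end
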